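import Summits.QuantumFields.YangMills.Theorems.BalabanUVNodesN11GaussianCertificateRows

/-!
# DAG node N11 — THE NO-EXPANSION 𝐓-IMAGE CLAUSE FOR A GIVEN WITNESS at a Gaussian certificate: for every parameter of the Gaussian class and EVERY k-local term-value
# witness carrying the level-`k` dichotomy at the parent history, the clause at a no-expansion history holds as soon as def-T's two operand rows hold for THAT witness —
# the witness-KEYED form dag-n11-e's witness chain asks for (no `∃`-produced witness, no (K0b) row, no thin-region exception)

HEADER — WORK-UNIT METADATA.  Cell `pub-ymgap`, YM-PLAN Track A (D-0062 ∕ D-0149 width seats), seat `pub-ymgap-dag-n11-w1` (g0; WIDTH SEAT 1 of 4 on NODE n11 [B14]),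
route `BalabanUVNodes` rev 25, item K1⁷ `StabilityBAtRecordR13SepCoPH` = stmt-QuantumFields-20542 (helper, `--kind proof --supports 20542 --as helper`, count-neutral).
[III] = [Balaban1988Convergent].  Composition of dag-n11-d's PER-WITNESS face `…N11NoExpansionOldBranchGraph.clause_succ_CoPH_of_Omega_empty_of_pinChi_of_oldBranch_of_clause_of_graph`
(g10 door (d1)+(d2)), dag-n11-w4's `…N11AFibreDominationOfCoercive.integrable_oldBranch_of_coercive` (door (d3) from coercivity), dag-n11-d's
`…N11FluctTruncationDefs.action23_sect2ActionDataOfRecord_congr_fluct_of_isFluctLocal`, and this seat's `…N11GaussianCertificateRows` (every residual row is a theorem in the class).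

WHY THIS FILE.  dag-n11-e g15's WITNESS CHAIN (`…N11Sect3SupplyChainDefs`: `NoExpansionClauseFor θ p k t Ek`, THEOREM 1 along the chain) asks the no-expansion clause FOR A GIVEN
witness — the chain's (iterated splices of the suppliers' terms) — not for the `∃`-produced k-truncation of dag-n11-d's witness-first faces or of this seat's
`exists_local_witness_clause_succ_of_sLaw₁₃CoPH_of_gaussCert`.  At a Gaussian certificate this is available: §1 proves the clause at ONE no-expansion history for ANY `k`-local
term value `t` and constant `E₀` carrying the level-`k` dichotomy at the parent, modulo def-T's operand rows for `(t, E₀)`; §2 packages it for an exposed witness family.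

WHAT THIS FILE PROVES (0 `sorry`, 0 `def`; nothing of Bałaban asserted).  §1 ★★★ `clause_succ_of_gaussCert_of_witness` (one history, one witness value).  §2 ★★
`noExpansionClause_of_gaussCert_of_witnessFamily` (every no-expansion history, for an exposed `k`-local witness family `(t, E_k)` of `ρ_k`'s §2 form — the shape of
dag-n11-e's `NoExpansionClauseFor θ p k t Ek` modulo the operand rows).

HONEST FRAMING.  Helper lane of K1⁷; kernel composition; the operand rows (def-T ∕ dag-n11-d (d4)) stay DISPLAYED; a Gaussian certificate carries a RANGE value of `quad`
(no-expansion analysis only), NOT node00-def-K0b's value of record; nothing of Bałaban asserted.  N11 NOT discharged; K1⁷ NOT closed; counts unmoved (typed 28∕28 ·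
discharged 5∕27).  R4 closes only the conditional finite-𝕋⁴ rung `BalabanLadder.UV` of one programme at fixed `ε = L^{−K}` — NOT ℝ⁴, NOT OS, NOT a mass gap, NOT Clay.
No `sorry`, `axiom`, `instance`, `notation`.
Sources (SHAPE only): [III] Theorem p.245, Thm 1 p.262, (3.24)–(3.25) p.270, (2.18) p.257, (2.21)–(2.23) p.258, (3.16)–(3.21) pp.268–269, (3.23) p.270.
-/

noncomputable section

open MeasureTheory
open scoped BigOperators ENNReal NNReal Matrix.Norms.L2Operator

namespace Summit.QuantumFields.YangMills.Theorems.BalabanUVNodesN11NoExpansionClauseGaussCertWitness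

open Literature.MathematicalPhysics.QuantumFieldTheory.Balaban1983to89 T4Continuum Node00 Node00.Tk
open B10Eq42TorusConstraint (bondsIn)
open BalabanUVNodesN11HistoryPinnedResidualDefs (ZhPinOfRecord₁₃)
open BalabanUVNodesN11FluctTruncationDefs (IsFluctLocal action23_sect2ActionDataOfRecord_congr_fluct_of_isFluctLocal)
open BalabanUVNodesN11NoExpansionOldBranchGraph (clause_succ_CoPH_of_Omega_empty_of_pinChi_of_oldBranch_of_clause_of_graph)
open BalabanUVNodesN11AFibreDominationOfCoercive (integrable_oldBranch_of_coercive)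
open BalabanUVNodesN11GaussianCertificateRows

variable {F : T4Family} {N : ℕ} [NeZero N]
variable (θ : Stage13HParams F N) (p : B12.RunParams)

/-! ## §1  ★★★ One no-expansion history, one witness value -/

/-- **★★★ THE NO-EXPANSION 𝐓-IMAGE CLAUSE AT A GAUSSIAN CERTIFICATE FOR A GIVEN WITNESS VALUE**: for `θ` of the Gaussian class (certificate `ζ0`, A-fibre Gaussian `quad`) with
core provisos, `k < K`, `1 ≤ M`, a no-expansion history `s′` of length `k+1`, and ANY `k`-local term value `t` with constant `E₀` carrying the level-`k` dichotomy of `ρ_k` at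
`init s′` (zero, or the §2 form `sect2Slot … t E₀` a.e. on `supp χ_k`): the 𝐓-image clause at `s′` for `(t, E₀)` holds as soon as, for every old branch, the operand
`exp A_k(init s′)[t, E₀]` is measurable and bounded on the multiscale configuration space (def-T's rows).  dag-n11-d's per-witness door (d1)+(d2) face, door (d3) by
dag-n11-w4's coercive integrability, every residual row by `…N11GaussianCertificateRows`.
[cite: Balaban1988Convergent, Theorem p.245, Thm 1 p.262, (3.24)–(3.25) p.270, (2.18) p.257, (2.21)–(2.23) p.258, (3.16)–(3.21) pp.268–269] -/
theorem clause_succ_of_gaussCert_of_witness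
    (hζ : ∀ (p : B12.RunParams) (n : ℕ) (Ω Λ : ℕ → Set (Site (F.P p.K) 0)), (θ.Zh p n Ω Λ).ζ0 = (ZhPinOfRecord₁₃ θ.toStage13Params p Ω Λ).ζ0)
    (hq : ∀ (p : B12.RunParams) (n : ℕ) (Ω Λ : ℕ → Set (Site (F.P p.K) 0)) (j : ℕ) (Λ' : Set (Site (F.P p.K) 0)) (ω : MultiCfg (F.P p.K) (SU N) (FluctV N)),
      (θ.Zh p n Ω Λ).quad j Λ' ω = ∑ b ∈ (Set.toFinite (bondsIn j (Λ'ᶜ ∩ Ω (j + 1)))).toFinset, ‖(ω j).2 b‖ ^ 2)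
    (h : θ.Provisos₁₃CoPH F N) {k : ℕ} (hk : k < p.K) (hM : 1 ≤ θ.τ9.M)
    (s : SeqOfRecord F θ.ν θ.τ9.M (gOfRecord₁₃ F N θ.toStage13Params p) p.K (k + 1)) (hΩ : s.Ω (k + 1) = ∅)
    (t : Sect2.TermValues (F.P p.K) (MatA N) (FluctV N) θ.τ9.M) (E₀ : ℝ) (hloc : IsFluctLocal k t)
    (hid : slotsOfRecord F N θ.ν θ.τ9 (EOfRecord₁₃ F N θ.toStage13Params) (wOfRecord₉ F N θ.toStage9Params) θ.ppSel p
        (gOfRecord₁₃ F N θ.toStage13Params p) k s.init = 0 ∨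
      ∀ᵐ U₀ ∂fieldMeasure (F.P p.K) k (SU N),
        chiSeqOfRecord F N θ.ν θ.τ9.M (gOfRecord₁₃ F N θ.toStage13Params p) p.K k s.init U₀ ≠ 0 →
          slotsOfRecord F N θ.ν θ.τ9 (EOfRecord₁₃ F N θ.toStage13Params) (wOfRecord₉ F N θ.toStage9Params) θ.ppSel p
              (gOfRecord₁₃ F N θ.toStage13Params p) k s.init U₀ =
            sect2Slot F N (FluctV N) p.K (settingOfRecord₁₃ F N θ.toStage13Params p) (θ.rzAt p s.init) (WtOfRecord₁₃H F N θ p s.init) s.init t E₀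
              (UbgOfRecord₁₃CoP F N θ.toStage13Params p k s.init) U₀)
    (hΦ : ∀ S ∈ admSOfRecord F θ.ν θ.τ9.M (gOfRecord₁₃ F N θ.toStage13Params p) p.K k s.init,
      Measurable (fun ω : MultiCfg (F.P p.K) (SU N) (FluctV N) =>
        sect2Operand F N (FluctV N) p.K (settingOfRecord₁₃ F N θ.toStage13Params p) (θ.rzAt p s.init) s.init t E₀
            (UbgOfRecord₁₃CoP F N θ.toStage13Params p k s.init) (S, fun j => (ω j).2) (fun j => (ω j).1)) ∧
      ∃ CΦ : ℝ, ∀ a U, sect2Operand F N (FluctV N) p.K (settingOfRecord₁₃ F N θ.toStage13Params p) (θ.rzAt p s.init) s.init t E₀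
            (UbgOfRecord₁₃CoP F N θ.toStage13Params p k s.init) a U ≤ CΦ) :
    slotsTOfRecord F N θ.ν θ.τ9 (EOfRecord₁₃ F N θ.toStage13Params) (wOfRecord₉ F N θ.toStage9Params) θ.ppSel p
        (gOfRecord₁₃ F N θ.toStage13Params p) (k + 1) s = 0 ∨
      ∀ᵐ V' ∂fieldMeasure (F.P p.K) (k + 1) (SU N),
        chiSeqOfRecord F N θ.ν θ.τ9.M (gOfRecord₁₃ F N θ.toStage13Params p) p.K (k + 1) s V' ≠ 0 →
          slotsTOfRecord F N θ.ν θ.τ9 (EOfRecord₁₃ F N θ.toStage13Params) (wOfRecord₉ F N θ.toStage9Params) θ.ppSel p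
              (gOfRecord₁₃ F N θ.toStage13Params p) (k + 1) s V' =
            sect2Slot F N (FluctV N) p.K (settingOfRecord₁₃ F N θ.toStage13Params p) (θ.rzAt p s) (WtOfRecord₁₃H F N θ p s) s t E₀
              (UbgOfRecord₁₃CoP F N θ.toStage13Params p (k + 1) s) V' := by
  refine clause_succ_CoPH_of_Omega_empty_of_pinChi_of_oldBranch_of_clause_of_graph θ p h hk hM s hΩ (quad_local_of_gaussCert θ p hq s)
    (prefix_agree_of_gaussCert θ p hζ hq s hΩ) t E₀
    (fun S a a' Uf ha => action23_sect2ActionDataOfRecord_congr_fluct_of_isFluctLocal p.K _ _ s.init hloc E₀ S a a' ha Uf)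
    hid (ζ0_pin_of_gaussCert θ p hζ hk s hΩ) (quad_empty_pairCfgAt_of_gaussCert θ p hq s) fun S hSm => ?_
  obtain ⟨hΦm, CΦ, hΦle⟩ := hΦ S hSm
  exact integrable_oldBranch_of_coercive θ p h.zhLaws (zhUnity_of_gaussCert θ hζ) s S (fun j Y => measurable_ζ0_of_gaussCert θ p hζ h s j Y)
    (fun j Λ' => measurable_quad_of_gaussCert θ p hq s j Λ') (coercive_of_gaussCert θ p hq s)
    (Φ := sect2Operand F N (FluctV N) p.K (settingOfRecord₁₃ F N θ.toStage13Params p) (θ.rzAt p s.init) s.init t E₀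
      (UbgOfRecord₁₃CoP F N θ.toStage13Params p k s.init))
    hΦm (fun a U => (sect2Operand_pos p.K _ _ s.init t E₀ _ a U).le) CΦ hΦle

/-! ## §2  ★★ Every no-expansion history, for an exposed k-local witness family -/

/-- **★★ THE NO-EXPANSION CLAUSE AT EVERY NO-EXPANSION HISTORY FOR A GIVEN EXPOSED WITNESS FAMILY** `(t, E_k)` of `ρ_k`'s §2 form (def-T's `HasSect2FormAtZS`), `k`-local,
at a Gaussian certificate, modulo def-T's operand rows for `(t (init s′), E_k(init s′))` — the shape of dag-n11-e's witness-keyed `NoExpansionClauseFor θ p k t Ek`.  Any such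
family serves (the chain's spliced witness included), not only an `∃`-produced truncation. [cite: Balaban1988Convergent, Theorem p.245, Thm 1 p.262, (3.24)–(3.25) p.270, (2.23) p.258] -/
theorem noExpansionClause_of_gaussCert_of_witnessFamily
    (hζ : ∀ (p : B12.RunParams) (n : ℕ) (Ω Λ : ℕ → Set (Site (F.P p.K) 0)), (θ.Zh p n Ω Λ).ζ0 = (ZhPinOfRecord₁₃ θ.toStage13Params p Ω Λ).ζ0)
    (hq : ∀ (p : B12.RunParams) (n : ℕ) (Ω Λ : ℕ → Set (Site (F.P p.K) 0)) (j : ℕ) (Λ' : Set (Site (F.P p.K) 0)) (ω : MultiCfg (F.P p.K) (SU N) (FluctV N)),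
      (θ.Zh p n Ω Λ).quad j Λ' ω = ∑ b ∈ (Set.toFinite (bondsIn j (Λ'ᶜ ∩ Ω (j + 1)))).toFinset, ‖(ω j).2 b‖ ^ 2)
    (h : θ.Provisos₁₃CoPH F N) {k : ℕ} (hk : k < p.K) (hM : 1 ≤ θ.τ9.M)
    (t : SeqOfRecord F θ.ν θ.τ9.M (gOfRecord₁₃ F N θ.toStage13Params p) p.K k → Sect2.TermValues (F.P p.K) (MatA N) (FluctV N) θ.τ9.M)
    (Ek : SeqOfRecord F θ.ν θ.τ9.M (gOfRecord₁₃ F N θ.toStage13Params p) p.K k → ℝ)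
    (hform : HasSect2FormAtZS F N (FluctV N) p.K (settingOfRecord₁₃ F N θ.toStage13Params p) k (θ.rzAt p) (WtOfRecord₁₃H F N θ p)
        (UbgOfRecord₁₃CoP F N θ.toStage13Params p k)
        (fun s₀ t₀ => Sect2.LawsRT (sect2TowerOfRecord F N (FluctV N) p.K (settingOfRecord₁₃ F N θ.toStage13Params p) (θ.rzAt p s₀) s₀ t₀)
          (settingOfRecord₁₃ F N θ.toStage13Params p).lf k)
        (slotsOfRecord F N θ.ν θ.τ9 (EOfRecord₁₃ F N θ.toStage13Params) (wOfRecord₉ F N θ.toStage9Params) θ.ppSel p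
          (gOfRecord₁₃ F N θ.toStage13Params p) k) t Ek)
    (hloc : ∀ s₀, IsFluctLocal k (t s₀)) :
    ∀ (s : SeqOfRecord F θ.ν θ.τ9.M (gOfRecord₁₃ F N θ.toStage13Params p) p.K (k + 1)), s.Ω (k + 1) = ∅ →
      (∀ S ∈ admSOfRecord F θ.ν θ.τ9.M (gOfRecord₁₃ F N θ.toStage13Params p) p.K k s.init,
        Measurable (fun ω : MultiCfg (F.P p.K) (SU N) (FluctV N) =>
          sect2Operand F N (FluctV N) p.K (settingOfRecord₁₃ F N θ.toStage13Params p) (θ.rzAt p s.init) s.init (t s.init) (Ek s.init)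
              (UbgOfRecord₁₃CoP F N θ.toStage13Params p k s.init) (S, fun j => (ω j).2) (fun j => (ω j).1)) ∧
        ∃ CΦ : ℝ, ∀ a U, sect2Operand F N (FluctV N) p.K (settingOfRecord₁₃ F N θ.toStage13Params p) (θ.rzAt p s.init) s.init (t s.init) (Ek s.init)
              (UbgOfRecord₁₃CoP F N θ.toStage13Params p k s.init) a U ≤ CΦ) →
      (slotsTOfRecord F N θ.ν θ.τ9 (EOfRecord₁₃ F N θ.toStage13Params) (wOfRecord₉ F N θ.toStage9Params) θ.ppSel p
          (gOfRecord₁₃ F N θ.toStage13Params p) (k + 1) s = 0 ∨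
        ∀ᵐ V' ∂fieldMeasure (F.P p.K) (k + 1) (SU N),
          chiSeqOfRecord F N θ.ν θ.τ9.M (gOfRecord₁₃ F N θ.toStage13Params p) p.K (k + 1) s V' ≠ 0 →
            slotsTOfRecord F N θ.ν θ.τ9 (EOfRecord₁₃ F N θ.toStage13Params) (wOfRecord₉ F N θ.toStage9Params) θ.ppSel p
                (gOfRecord₁₃ F N θ.toStage13Params p) (k + 1) s V' =
              sect2Slot F N (FluctV N) p.K (settingOfRecord₁₃ F N θ.toStage13Params p) (θ.rzAt p s) (WtOfRecord₁₃H F N θ p s) s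
                (t s.init) (Ek s.init) (UbgOfRecord₁₃CoP F N θ.toStage13Params p (k + 1) s) V') :=
  fun s hΩ hΦ => clause_succ_of_gaussCert_of_witness θ p hζ hq h hk hM s hΩ (t s.init) (Ek s.init) (hloc s.init) (hform.2 s.init).2 hΦ

end Summit.QuantumFields.YangMills.Theorems.BalabanUVNodesN11NoExpansionClauseGaussCertWitness

end
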